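import Summits.PneNP.PneNP.Theorems.MonotoneBlind.Negative.LoadBearing

/-!
# Route KarlinRubin, crux `MonotoneSuffices` (stmt-PneNP-18026): the provable sandwich

`MonotoneSuffices` (X₁ of route KarlinRubin) says: for every `δ ∈ (0,1/2)` there is an exponent `a`
such that for every budget `s`, a `B₂`-circuit family of size `≤ s(n)` strongly detecting the planted
`⌈n^{1/2-δ}⌉`-clique in `G(n,1/2)` can be replaced by a family over `{∧₂, ∨₂, 0, 1}` of size
`≤ (s(n)+n)^a`. Using the brute-force monotone detector already landed for the sibling crux
(`MonotoneBlind.Negative.exists_monotone_strongDetector`: the OR-of-ANDs `(3⌊log₂ n⌋+3)`-clique test,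
monotone over `{∧₂, ∨₂, 0, 1}` at every `n`, size `≤ n^(3⌊log₂ n⌋+5)` eventually, error sum `→ 0` at
every clique exponent `ε ∈ (0,1]`), this file proves, sorry-free (helpers `--supports stmt-PneNP-18026`):

* `karlinRubin_monotoneSuffices_conclusion_of_largeBudget` — the CONCLUSION of `MonotoneSuffices` holds
  outright (with `a = 1`) for every budget with `n^(3⌊log₂ n⌋+5) ≤ s(n) + n` eventually;
* `karlinRubin_monotoneSuffices_of_quasipolyHard` — `MonotoneSuffices` FOLLOWS from quasi-polynomial
  nonuniform planted-clique hardness ("every strongly detecting `B₂` family has `n^⌊log₂ n⌋ ≤ size^c`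
  eventually"), the strong form of the planted clique conjecture (Jerrum 1992 §5; Barak et al. 2019 §1)
  matching the `n^{Θ(log n)}` time of the best known algorithms below `√n`; contrapositively, a
  refutation of `MonotoneSuffices` must exhibit `B₂` detectors with `size^c < n^⌊log₂ n⌋` infinitely
  often for every `c`, i.e. beat every known planted-clique algorithm;
* `karlinRubin_noPolyDetector_of_monotoneSuffices_of_monotoneBlind` — `MonotoneSuffices ∧ MonotoneBlind`
  gives polynomial nonuniform planted-clique hardness at every `δ` (the upper slice, as used by `closes`).

So `QuasiPolyHard → MonotoneSuffices → (MonotoneBlind → PolyHard)`; both neighbours are open forms of the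
planted clique conjecture, which is the precise sense in which the crux is an open problem: proving it
needs either an average-case monotone SIMULATION theorem for this distribution pair (no technique known;
cf. Tardos 1988 worst case) or quasi-polynomial circuit lower bounds for planted clique; refuting it
needs an `n^{o(log n)}` detection algorithm below `√n`.
-/

set_option linter.dupNamespace false -- `Summit.PneNP.PneNP.…`: summit = sub-problem (D-0017)

namespace Summit.PneNP.PneNP.Theorems

open Filter Topology Finset
open scoped ENNReal
open Literature.Computability.Complexity
open Literature.Probability.RandomGraphs.PlantedClique
open Summit.PneNP.PneNP.Theses.KarlinRubin
open Summit.PneNP.PneNP.Theorems.MonotoneBlind.Negative (exists_monotone_strongDetector)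

/-! ### The sandwich -/

/-- **`MonotoneSuffices` holds at the top, unconditionally.** For every `δ ∈ (0,1/2)` and every budget
`s` with `n^(3⌊log₂ n⌋+5) ≤ s(n) + n` eventually, the conclusion of `MonotoneSuffices` holds with exponent
`a = 1` — whatever the hypothesis: the brute-force monotone detector fits the budget. [folklore] -/
theorem karlinRubin_monotoneSuffices_conclusion_of_largeBudget (δ : ℝ) (hδ : 0 < δ) (hδ' : δ < 1 / 2)
    (s : ℕ → ℕ) (hs : ∀ᶠ n : ℕ in atTop, n ^ (3 * Nat.log 2 n + 5) ≤ s n + n) :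
    ∃ C' : (n : ℕ) → Circuit ((⊤ : SimpleGraph (Fin n)).edgeSet),
      (∀ᶠ n : ℕ in atTop, (C' n).IsOver monotoneBasis01 ∧ (C' n).size ≤ (s n + n) ^ 1) ∧
      Tendsto (fun n : ℕ =>
        (erdosRenyiHalf n).toOuterMeasure {x | (C' n).eval x = true} +
          (plantedCliqueDist n ⌈(n : ℝ) ^ (1 / 2 - δ)⌉₊).toOuterMeasure {x | (C' n).eval x = false})
        atTop (𝓝 0) := by
  obtain ⟨C, hB, hC, hT⟩ := exists_monotone_strongDetector (ε := 1 / 2 - δ) (by linarith) (by linarith)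
  refine ⟨C, ?_, hT⟩
  filter_upwards [hC, hs] with n hn hsn
  exact ⟨hB n, by rw [pow_one]; exact hn.trans hsn⟩

/-- **Lower slice of the sandwich: quasi-polynomial planted-clique hardness implies
`MonotoneSuffices`.** If for every `δ ∈ (0,1/2)` there is `c` such that every `B₂`-circuit family whose
error sum at clique size `⌈n^{1/2-δ}⌉` tends to `0` has `n^⌊log₂ n⌋ ≤ size^c` eventually (size
`≥ n^(⌊log₂ n⌋/c)`: the quasi-polynomial, nonuniform form of the planted clique conjecture, matching the
`n^{Θ(log n)}` running time of the best known algorithms below `√n`; Jerrum 1992 §5, Barak et al. 2019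
§1), then `MonotoneSuffices` holds with `a = 4c`: the budget `s(n)` is then itself quasi-polynomial and
the brute-force monotone detector of size `n^(3⌊log₂ n⌋+5) ≤ (n^⌊log₂ n⌋)^4 ≤ s(n)^(4c)` fits.
Contrapositive: a refutation of `MonotoneSuffices` at `δ` produces, for every `c`, a strongly detecting
`B₂` family with `size^c < n^⌊log₂ n⌋` infinitely often. [cite: Jerrum1992, §5] -/
theorem karlinRubin_monotoneSuffices_of_quasipolyHard
    (H : ∀ δ : ℝ, 0 < δ → δ < 1 / 2 → ∃ c : ℕ,
      ∀ C : (n : ℕ) → Circuit ((⊤ : SimpleGraph (Fin n)).edgeSet),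
        (∀ᶠ n : ℕ in atTop, (C n).IsOver B2) →
        Tendsto (fun n : ℕ =>
          (erdosRenyiHalf n).toOuterMeasure {x | (C n).eval x = true} +
            (plantedCliqueDist n ⌈(n : ℝ) ^ (1 / 2 - δ)⌉₊).toOuterMeasure {x | (C n).eval x = false})
          atTop (𝓝 0) →
        ∀ᶠ n : ℕ in atTop, n ^ (Nat.log 2 n) ≤ (C n).size ^ c) :
    MonotoneSuffices := by
  intro δ hδ hδ'
  obtain ⟨c, hc⟩ := H δ hδ hδ'
  refine ⟨4 * c, fun s ⟨C, hC, hT⟩ => ?_⟩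
  obtain ⟨C', hB', hC', hT'⟩ := exists_monotone_strongDetector (ε := 1 / 2 - δ) (by linarith) (by linarith)
  refine ⟨C', ?_, hT'⟩
  have hhard := hc C (hC.mono fun n h => h.1) hT
  filter_upwards [hC', hC, hhard, eventually_ge_atTop 32] with n hn hCn hh h32
  refine ⟨hB' n, hn.trans ?_⟩
  have hL : 5 ≤ Nat.log 2 n := by
    have : 2 ^ 5 ≤ n := by norm_num; omega
    exact Nat.le_log_of_pow_le (by norm_num) this
  have hpos : 0 < n := by omega
  calc n ^ (3 * Nat.log 2 n + 5) ≤ n ^ (4 * Nat.log 2 n) :=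
        Nat.pow_le_pow_right hpos (by omega)
    _ = (n ^ (Nat.log 2 n)) ^ 4 := by rw [← pow_mul, mul_comm]
    _ ≤ ((C n).size ^ c) ^ 4 := Nat.pow_le_pow_left hh 4
    _ ≤ ((s n) ^ c) ^ 4 := Nat.pow_le_pow_left (Nat.pow_le_pow_left hCn.2 c) 4
    _ = (s n) ^ (4 * c) := by rw [← pow_mul, mul_comm]
    _ ≤ (s n + n) ^ (4 * c) := Nat.pow_le_pow_left (Nat.le_add_right _ _) _

/-- **Upper slice of the sandwich.** `MonotoneSuffices` together with `MonotoneBlind` rules out every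
polynomial-size `B₂`-circuit family strongly detecting the planted `⌈n^{1/2-δ}⌉`-clique, for every
`δ ∈ (0, 1/2)` (nonuniform polynomial planted-clique hardness — what the deciding theorem `closes`
contradicts with the bridge circuits). [folklore] -/
theorem karlinRubin_noPolyDetector_of_monotoneSuffices_of_monotoneBlind
    (hSim : MonotoneSuffices) (hLB : MonotoneBlind) :
    ∀ δ : ℝ, 0 < δ → δ < 1 / 2 → ∀ c : ℕ, ¬ ∃ C : (n : ℕ) → Circuit ((⊤ : SimpleGraph (Fin n)).edgeSet),
      (∀ᶠ n : ℕ in atTop, (C n).IsOver B2 ∧ (C n).size ≤ n ^ c) ∧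
        Tendsto (fun n : ℕ =>
          (erdosRenyiHalf n).toOuterMeasure {x | (C n).eval x = true} +
            (plantedCliqueDist n ⌈(n : ℝ) ^ (1 / 2 - δ)⌉₊).toOuterMeasure {x | (C n).eval x = false})
          atTop (𝓝 0) := by
  intro δ hδ hδ' c ⟨C, hC, hT⟩
  obtain ⟨a, ha⟩ := hSim δ hδ hδ'
  obtain ⟨C', hC', hT'⟩ := ha (fun n => n ^ c) ⟨C, hC, hT⟩
  refine hLB δ hδ hδ' (a * (c + 2)) ⟨C', ?_, hT'⟩
  filter_upwards [hC', eventually_ge_atTop 2] with n hn h2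
  refine ⟨hn.1, hn.2.trans ?_⟩
  have hpos : 0 < n := by omega
  have h3 : n ^ c + n ≤ n ^ (c + 2) := by
    calc n ^ c + n ≤ n ^ (c + 1) + n ^ (c + 1) :=
          Nat.add_le_add (Nat.pow_le_pow_right hpos (Nat.le_succ c))
            (by calc n = n ^ 1 := (pow_one n).symm
                  _ ≤ n ^ (c + 1) := Nat.pow_le_pow_right hpos (by omega))
      _ = 2 * n ^ (c + 1) := by ring
      _ ≤ n * n ^ (c + 1) := Nat.mul_le_mul_right _ h2
      _ = n ^ (c + 2) := by ring
  calc (n ^ c + n) ^ a ≤ (n ^ (c + 2)) ^ a := Nat.pow_le_pow_left h3 a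
    _ = n ^ (a * (c + 2)) := by rw [← pow_mul, mul_comm]

end Summit.PneNP.PneNP.Theorems
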